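import Summits.SmoothPoincare4.Statement
import Literature.Topology.FourManifolds.HomotopySpheres
import Literature.Geometry.Riemannian.ConformallyFlat
import Literature.Geometry.Lorentzian.LeviCivita

/-!
# SmoothPoincare4 / PIC — assembly of the locally-conformally-flat branch

Problem `SmoothPoincare4`, topic `PIC` (item stmt-SmoothPoincare4-0477). Hypotheses: (hK) Kuiper's
theorem in dimension 4 (a compact simply connected locally conformally flat Riemannian 4-manifold
is diffeomorphic to `S⁴`; Kuiper 1949), (hSC) homotopy `S⁴` ⇒ simply connected, (hX) every
homotopy 4-sphere carries a locally conformally flat Riemannian metric. Conclusion: every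
`S : Literature.HomotopySphere 4` is diffeomorphic to `S⁴`. Six-line bookkeeping.
-/

open scoped Manifold ContDiff
open ContinuousMap

namespace Literature.SPC4

/-- Settles stmt-SmoothPoincare4-0477: (Kuiper 1949, dimension 4, as hypothesis) → (homotopy
`S⁴` ⇒ simply connected) → (every homotopy 4-sphere has a locally conformally flat Riemannian
metric) → every homotopy 4-sphere is diffeomorphic to `S⁴`. [Kuiper 1949 (as hypothesis)]
[folklore] -/
theorem forall_homotopySphere_of_lcf
    (hK : ∀ (M : Type) [TopologicalSpace M] [T2Space M] [SecondCountableTopology M]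
      [ChartedSpace (EuclideanSpace ℝ (Fin 4)) M] [IsManifold (𝓡 4) ∞ M] [CompactSpace M]
      [SimplyConnectedSpace M],
      (∃ g : Literature.Geometry.Lorentzian.PseudoRiemannianMetric (𝓡 4) ∞ (EuclideanSpace ℝ (Fin 4))
        (TangentSpace (𝓡 4) : M → Type _), g.IsRiemannian ∧ g.IsLocallyConformallyFlat) →
      Nonempty (M ≃ₘ⟮𝓡 4, 𝓡 4⟯ Metric.sphere (0 : EuclideanSpace ℝ (Fin 5)) 1))
    (hSC : ∀ (M : Type) [TopologicalSpace M],
      M ≃ₕ Metric.sphere (0 : EuclideanSpace ℝ (Fin 5)) 1 → SimplyConnectedSpace M)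
    (hX : ∀ S : Literature.Topology.FourManifolds.HomotopySphere 4,
      ∃ g : Literature.Geometry.Lorentzian.PseudoRiemannianMetric (𝓡 4) ∞ (EuclideanSpace ℝ (Fin 4))
        (TangentSpace (𝓡 4) : S.carrier → Type _), g.IsRiemannian ∧ g.IsLocallyConformallyFlat) :
    ∀ S : Literature.Topology.FourManifolds.HomotopySphere 4,
      Nonempty (S.carrier ≃ₘ⟮𝓡 4, 𝓡 4⟯ Metric.sphere (0 : EuclideanSpace ℝ (Fin 5)) 1) := by
  intro S
  obtain ⟨e⟩ := S.nonempty_homotopyEquiv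
  haveI := hSC S.carrier e
  exact hK S.carrier (hX S)

end Literature.SPC4
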